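import Summits.QuantumFields.YangMills.Theorems.UnitScaleTiltProp7CombWalkMassTwoBlock
import Summits.QuantumFields.YangMills.Theorems.UnitScaleTiltProp7CombTowerRowsOfRegPrT3
import HarnessLib

/-!
# Route `UnitScaleTilt`, crux K1 «MinimiserStabilityRegPr» (stmt-QuantumFields-19200), route-R E′ (A′)-on-Σ, P-A2 (β), row `hMcomb₂` ⟸ H2-1 — file H-3b (member)
# «THE SECOND-ORDER DEFECT RECURSION OF PRINT's SINGLE BARS AT A PRINTED-REGULAR BACKGROUND»: member `(F, n ≤ K)`, `W ∈ 𝔘_k(ε₀)` (`10⁷L⁴ε₀ ≤ 1`), Hermitian traceless `X` with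
# `nMax19 W X < ε₀∕6`; letters `W♯ = pull (bgUnits W) x₀`, `(iX)♯(x, μ) = I•X⟨x₀ + x, μ⟩`, `Ũˡ = tildIter L W♯ (e^{(iX)♯}) l`, `E_l := (Ũˡ − 1) − Q l (iX)♯` for ★routeR-w1's
# linearised cornered tower `Q`: **`‖E_{l+1}(z,κ) − T_l(E_l)(L•z,κ)‖ ≤ 260·((2d+2)L)²·M₂,l(z,κ)`** for EVERY `l < K − n` and EVERY coarse bond, F-2b's windows DISCHARGED at `RegPr`

Cell `ym3-torus` (HUMAN RULING D-0037: YM₃ on the torus is ladder rung R3 — not d = 4, not a mass gap, not Clay), width seat `ym3-torus-px17` (gen 4); ★★OWNER RULINGS №20 (1) (`hMcomb₂`),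
№22 (c); ★routeR-w1 g9 07:08:36Z.  `--supports stmt-QuantumFields-19200 --as helper`; THEOREMS ONLY (0 `def`, 0 `sorry`); count-neutral.  «route-internal row (n3)-comb₂ — NOT N06,
NOT a print row; OPEN».  Nothing of `hMcomb`, `hMcomb₂`, H2-1, (β), `hPA2`, `hcoS`, E′, EX, the crux, d = 4 or the gap is claimed.

THE POINT.  H-3a (✓`Prop7CombWalkMassTwoBlock.norm_rem2_succ_sub_trueStep_le_twoBlock`) is the recursion of the second-order defect of print's single bars ([Balaban1985Averaging] (65)∕(68))
with F-2b's remainder as source, `≤ 260·((2d+2)L)²·M₂(c)` in ★routeR-w1 F-5b's two-block letter, under DISPLAYED windows: `Ū₀ˡ` unitary-valued, `Ũˡ ∈ U1`, the step-mass window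
`72·(2d+2)L·√M₂(c) ≤ 1`, and the background block loops `‖W(Ū₀ˡ)(c, r) − 1‖ ≤ α ≤ 1∕24`.  At the member ALL FOUR hold for every `l ≤ K − n` at a printed-regular background:
unitarity of `Ū₀ˡ♯` and of `Ũˡ`, and the sup row `‖Ũˡ − 1‖ ≤ 65ε₀` (★routeR-w6 g8 ✓`Prop7CombTowerRowsOfRegPr.comb_level_rows_of_regPr`, [Balaban1985Averaging] (159)–(163) read through
[Balaban1985RegularSpaces] Prop. 7 and (19) of [Balaban1985Variational]) give `√M₂ ≤ 3L²·65ε₀` hence `72·8L·√M₂ ≤ 112320·L³ε₀ ≤ 1`; the background loops are `≤ 1∕64` (displayed here as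
`hW64` — the one row ★routeR-w2 g10's H-3 letters file supplies, lit ✓`B7Eq123General.level_data` ∘ ✓`B7Prop2Explicit.norm_Wcx_sub_one_le`).  With H-1 (✓`Prop7CombTildLinearResponse.
fderiv_coe_tildIter_eq_linTower`, family `A′ ↦ (e^{A′})♯` through `1`, velocity `(iX)♯`), `E_l(ẑ, κ)` IS px13 g6's SIGNATURE-0′ `hMcomb₂` summand vector
`↑Ũˡ(ẑ,κ) − 1 − fderiv ℂ (A′ ↦ ↑(Ũˡ[(e^{A′})♯](ẑ,κ))) 0 (iX)`; so `hMcomb₂` ⟸ `hMcomb` ⊕ H2-1, where H2-1 := the `ℓ¹` bound over one period cell of the solution `E` of THIS inhomogeneous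
linear recursion (sources dominated by the two-block masses of `Ũˡ − 1`, whose cell sums are `hMcomb`'s currency by F-5c-class tiling) — px18 g4's FLAT H2-1 KNIT ∕ ★routeR-w1's F-6 letters.

WHAT IS PROVED (ns `…Theorems.Prop7CombTildRem2OfRegPrT3`): `sqrt_twoBlock_le_of_sup` (the window arithmetic), ★★★ `norm_rem2_succ_sub_trueStep_le_of_regPr` (the title).
HONEST SCOPE.  Window arithmetic over H-3a and ★routeR-w6's member rows; `hW64` and the `Q`-recursion text displayed; no cell sum, no periodicity, no estimate of `E`; H2-1 OPEN.
Rung R3, not Clay; YM gap NOT proved.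

References: T. Bałaban, CMP **98** (1985) 17–51 [Balaban1985Averaging] ((42) p.23, (65)∕(68)∕(69) p.29, Prop. 3 (113)–(126) pp.34–36, (159)–(163) p.42); CMP **99** (1985) 75–102
[Balaban1985RegularSpaces] (Prop. 7 (1.139)–(1.141) p.100); CMP **102** (1985) 277–309 [Balaban1985Variational] ((19) p.281); CMP **109** (1987) 249–301 [Balaban1987RG1] ((0.4) p.253).
-/

set_option autoImplicit false

noncomputable section

open scoped BigOperators Matrix.Norms.L2Operator

namespace Summit.QuantumFields.YangMills.Theorems.Prop7CombTildRem2OfRegPrT3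

open NormedSpace
open Literature.MathematicalPhysics.QuantumFieldTheory.Balaban1983to89
open Literature.MathematicalPhysics.QuantumFieldTheory.Balaban1983to89.T3ContinuumYM3Torus
open T3PrintedRegularMinimiser (RegPr)
open T3SectALandauChart (bgUnits)
open ExpMeanLog (eml)
open B7Prop1Explicit renaming Site → LSite
open B7Prop1Explicit (e seg boxVec gammaWord Wcx Xavg expUnit U1)
open B7Prop2Explicit (avgIter unitaryUnits unitaryUnits_le_U1)
open B7Prop3Flat (expCfg)
open B7Eq92Concrete (tildIter)
open B7Prop3GeneralRotated (tsum)
open B10Eq27TorusAxialLog (pull transl)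
open Summit.QuantumFields.YangMills.Theorems.Prop7SPrint (basePt)
open Summit.QuantumFields.YangMills.Theorems.Prop7TPrint (nMax19)
open Summit.QuantumFields.YangMills.Theorems.Prop7CombTowerRowsOfRegPr (comb_level_rows_of_regPr)
open Summit.QuantumFields.YangMills.Theorems.Prop7CombWalkMassTwoBlock (norm_rem2_succ_sub_trueStep_le_twoBlock)

section Member

variable (F : T3Family) {n K : ℕ}

/-- **Window arithmetic**: if every term of the two-block mass is at most `(65ε₀)²` (d = 3, `Lᵈ` box points, two blocks), then `√M₂ ≤ 3L²·65ε₀`; with `10⁷L⁴ε₀ ≤ 1` the F-2b step-mass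
window `72·(2d+2)L·√M₂ ≤ 1` follows. [cite: Balaban1985Averaging, (163) p.42, (124)-(126) p.36] -/
theorem sqrt_twoBlock_le_of_sup {ε₀ : ℝ} (hε₀ : 0 ≤ ε₀) (hε : 10 ^ 7 * (F.L : ℝ) ^ 4 * ε₀ ≤ 1) {f g : (Fin (F.P K).d → Fin (F.P K).L) → Fin (F.P K).d → ℝ}
    (hf : ∀ s ν, f s ν ≤ (65 * ε₀) ^ 2) (hg : ∀ s ν, g s ν ≤ (65 * ε₀) ^ 2) :
    Real.sqrt (∑ s, ∑ ν, (f s ν + g s ν)) ≤ 3 * (F.L : ℝ) ^ 2 * (65 * ε₀) ∧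
      72 * ((2 * ((F.P K).d : ℝ) + 2) * ((F.P K).L : ℝ) * Real.sqrt (∑ s, ∑ ν, (f s ν + g s ν))) ≤ 1 := by
  have hd3 : (F.P K).d = 3 := T3Family.P_d F K
  have hPL : (((F.P K).L : ℕ) : ℝ) = (F.L : ℝ) := rfl
  have hL3 : (3 : ℝ) ≤ F.L := by
    have h3 : 3 ≤ F.L := by obtain ⟨a, ha⟩ := F.hL.1; have := F.hL.2; omega
    exact_mod_cast h3
  have hterm : ∑ s, ∑ ν, (f s ν + g s ν) ≤ ∑ _s : Fin (F.P K).d → Fin (F.P K).L, ∑ _ν : Fin (F.P K).d, 2 * (65 * ε₀) ^ 2 :=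
    Finset.sum_le_sum fun s _ => Finset.sum_le_sum fun ν _ => by linarith [hf s ν, hg s ν]
  have hcount : (∑ _s : Fin (F.P K).d → Fin (F.P K).L, ∑ _ν : Fin (F.P K).d, 2 * (65 * ε₀) ^ 2 : ℝ) = 6 * (F.L : ℝ) ^ 3 * (65 * ε₀) ^ 2 := by
    simp only [Finset.sum_const, Finset.card_univ, Fintype.card_fun, Fintype.card_fin, nsmul_eq_mul, hd3]
    push_cast
    rw [hPL]
    ring
  rw [hcount] at hterm
  have h69 : 6 * (F.L : ℝ) ^ 3 * (65 * ε₀) ^ 2 ≤ (3 * (F.L : ℝ) ^ 2 * (65 * ε₀)) ^ 2 := by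
    have : 6 * (F.L : ℝ) ^ 3 ≤ 9 * (F.L : ℝ) ^ 4 := by nlinarith [pow_pos (by linarith : (0 : ℝ) < F.L) 3]
    nlinarith [sq_nonneg (65 * ε₀)]
  have hsqrt : Real.sqrt (∑ s, ∑ ν, (f s ν + g s ν)) ≤ 3 * (F.L : ℝ) ^ 2 * (65 * ε₀) := by
    calc Real.sqrt (∑ s, ∑ ν, (f s ν + g s ν)) ≤ Real.sqrt ((3 * (F.L : ℝ) ^ 2 * (65 * ε₀)) ^ 2) := Real.sqrt_le_sqrt (hterm.trans h69)
      _ = 3 * (F.L : ℝ) ^ 2 * (65 * ε₀) := Real.sqrt_sq (by positivity)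
  refine ⟨hsqrt, ?_⟩
  have hd3r : ((F.P K).d : ℝ) = 3 := by exact_mod_cast hd3
  rw [hd3r, hPL]
  calc 72 * ((2 * (3 : ℝ) + 2) * (F.L : ℝ) * Real.sqrt (∑ s, ∑ ν, (f s ν + g s ν)))
      ≤ 72 * ((2 * (3 : ℝ) + 2) * (F.L : ℝ) * (3 * (F.L : ℝ) ^ 2 * (65 * ε₀))) := by
        gcongr
    _ = 112320 * (F.L : ℝ) ^ 3 * ε₀ := by ring
    _ ≤ 10 ^ 7 * (F.L : ℝ) ^ 4 * ε₀ := by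
        have : 112320 * (F.L : ℝ) ^ 3 ≤ 10 ^ 7 * (F.L : ℝ) ^ 4 := by nlinarith [pow_pos (by linarith : (0 : ℝ) < F.L) 3]
        exact mul_le_mul_of_nonneg_right this hε₀
    _ ≤ 1 := hε

/-- ★★★ **THE SECOND-ORDER DEFECT RECURSION OF PRINT's SINGLE BARS AT A PRINTED-REGULAR BACKGROUND** (see the module docstring): for every `l < K − n` and every coarse bond `(z, κ)` of `ℤ³`,
with `Y_l := Ũˡ − 1`, `E_l := Y_l − Q l (iX)♯`, `c = (L•z, κ)`:
`‖E_{l+1}(z,κ) − T_l(E_l)(L•z,κ)‖ ≤ 260·((2d+2)L)²·Σ_{s ∈ [0,L)³, ν}(‖Y_l(L•z + s, ν)‖² + ‖Y_l(L•z + Le_κ + s, ν)‖²)`, for ANY family `Q` with ✓p704390's linearised-tower text at the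
member letters; DISPLAYED: the background loop row `hW64` (★routeR-w2 g10's letters file). [cite: Balaban1985Averaging, (65)-(69) p.29, Prop. 3 (113)-(126) pp.34-36, (159)-(163) p.42; Balaban1985RegularSpaces, Prop. 7 (1.139)-(1.141) p.100; Balaban1985Variational, (19) p.281; Balaban1987RG1, (0.4) p.253] -/
theorem norm_rem2_succ_sub_trueStep_le_of_regPr {ε₀ : ℝ} (hε₀ : 0 < ε₀) (hε : 10 ^ 7 * (F.L : ℝ) ^ 4 * ε₀ ≤ 1)
    (W : GaugeField (F.P K) 0 (Matrix.specialUnitaryGroup (Fin 2) ℂ)) (hreg : RegPr F n K ε₀ W)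
    (X : PBond (F.P K) 0 → Matrix (Fin 2) (Fin 2) ℂ) (hX : ∀ b, (X b).IsHermitian ∧ (X b).trace = 0) (hX6 : nMax19 F n K W X < ε₀ / 6)
    (hW64 : ∀ k : ℕ, k ≤ K - n → ∀ (q : LSite (F.P K).d) (κ : Fin (F.P K).d) (r : Fin (F.P K).d → Fin (F.P K).L),
      ‖((Wcx (F.P K).L (avgIter (F.P K).L (pull (bgUnits F K W) (basePt F n K)) k) q κ (boxVec (F.P K).L r) : (Matrix (Fin 2) (Fin 2) ℂ)ˣ) :
          Matrix (Fin 2) (Fin 2) ℂ) - 1‖ ≤ 1 / 64)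
    (Q : ℕ → (LSite (F.P K).d → Fin (F.P K).d → Matrix (Fin 2) (Fin 2) ℂ) → LSite (F.P K).d → Fin (F.P K).d → Matrix (Fin 2) (Fin 2) ℂ)
    (hQs : ∀ (k : ℕ) (Y : LSite (F.P K).d → Fin (F.P K).d → Matrix (Fin 2) (Fin 2) ℂ) (z : LSite (F.P K).d) (κ : Fin (F.P K).d),
      letI : CStarAlgebra (Matrix (Fin 2) (Fin 2) ℂ) := B10Eq29TubeLine.cstarAlgebraMatrix 2
      Q (k + 1) Y z κ
        = fderiv ℂ (eml : ((Fin (F.P K).d → Fin (F.P K).L) → Matrix (Fin 2) (Fin 2) ℂ) → Matrix (Fin 2) (Fin 2) ℂ)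
              (fun r => ((Wcx (F.P K).L (avgIter (F.P K).L (pull (bgUnits F K W) (basePt F n K)) k) (((F.P K).L : ℤ) • z) κ (boxVec (F.P K).L r) :
                (Matrix (Fin 2) (Fin 2) ℂ)ˣ) : Matrix (Fin 2) (Fin 2) ℂ))
              (fun r => tsum (avgIter (F.P K).L (pull (bgUnits F K W) (basePt F n K)) k) (Q k Y) (((F.P K).L : ℤ) • z)
                  (gammaWord (F.P K).L κ (boxVec (F.P K).L r) ++ seg κ (-((F.P K).L : ℤ)))
                * ((Wcx (F.P K).L (avgIter (F.P K).L (pull (bgUnits F K W) (basePt F n K)) k) (((F.P K).L : ℤ) • z) κ (boxVec (F.P K).L r) :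
                    (Matrix (Fin 2) (Fin 2) ℂ)ˣ) : Matrix (Fin 2) (Fin 2) ℂ))
              * (((expUnit (Xavg (F.P K).L (avgIter (F.P K).L (pull (bgUnits F K W) (basePt F n K)) k) (((F.P K).L : ℤ) • z) κ))⁻¹ :
                  (Matrix (Fin 2) (Fin 2) ℂ)ˣ) : Matrix (Fin 2) (Fin 2) ℂ)
            + ((expUnit (Xavg (F.P K).L (avgIter (F.P K).L (pull (bgUnits F K W) (basePt F n K)) k) (((F.P K).L : ℤ) • z) κ) : (Matrix (Fin 2) (Fin 2) ℂ)ˣ) :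
                  Matrix (Fin 2) (Fin 2) ℂ)
                * tsum (avgIter (F.P K).L (pull (bgUnits F K W) (basePt F n K)) k) (Q k Y) (((F.P K).L : ℤ) • z) (seg κ ((F.P K).L : ℤ))
              * (((expUnit (Xavg (F.P K).L (avgIter (F.P K).L (pull (bgUnits F K W) (basePt F n K)) k) (((F.P K).L : ℤ) • z) κ))⁻¹ :
                  (Matrix (Fin 2) (Fin 2) ℂ)ˣ) : Matrix (Fin 2) (Fin 2) ℂ))
    {l : ℕ} (hl : l < K - n) (z : LSite (F.P K).d) (κ : Fin (F.P K).d) :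
    letI : CStarAlgebra (Matrix (Fin 2) (Fin 2) ℂ) := B10Eq29TubeLine.cstarAlgebraMatrix 2
    ‖(((tildIter (F.P K).L (pull (bgUnits F K W) (basePt F n K)) (expCfg fun x μ => Complex.I • X ⟨transl (basePt F n K) x, μ⟩) (l + 1) z κ :
            (Matrix (Fin 2) (Fin 2) ℂ)ˣ) : Matrix (Fin 2) (Fin 2) ℂ) - 1 - Q (l + 1) (fun x μ => Complex.I • X ⟨transl (basePt F n K) x, μ⟩) z κ)
        - (fderiv ℂ (eml : ((Fin (F.P K).d → Fin (F.P K).L) → Matrix (Fin 2) (Fin 2) ℂ) → Matrix (Fin 2) (Fin 2) ℂ)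
              (fun r => ((Wcx (F.P K).L (avgIter (F.P K).L (pull (bgUnits F K W) (basePt F n K)) l) (((F.P K).L : ℤ) • z) κ (boxVec (F.P K).L r) :
                (Matrix (Fin 2) (Fin 2) ℂ)ˣ) : Matrix (Fin 2) (Fin 2) ℂ))
              (fun r => tsum (avgIter (F.P K).L (pull (bgUnits F K W) (basePt F n K)) l)
                  ((fun x μ => ((tildIter (F.P K).L (pull (bgUnits F K W) (basePt F n K)) (expCfg fun x μ => Complex.I • X ⟨transl (basePt F n K) x, μ⟩) l x μ :
                      (Matrix (Fin 2) (Fin 2) ℂ)ˣ) : Matrix (Fin 2) (Fin 2) ℂ) - 1)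
                    - Q l (fun x μ => Complex.I • X ⟨transl (basePt F n K) x, μ⟩))
                  (((F.P K).L : ℤ) • z) (gammaWord (F.P K).L κ (boxVec (F.P K).L r) ++ seg κ (-((F.P K).L : ℤ)))
                * ((Wcx (F.P K).L (avgIter (F.P K).L (pull (bgUnits F K W) (basePt F n K)) l) (((F.P K).L : ℤ) • z) κ (boxVec (F.P K).L r) :
                    (Matrix (Fin 2) (Fin 2) ℂ)ˣ) : Matrix (Fin 2) (Fin 2) ℂ))
              * (((expUnit (Xavg (F.P K).L (avgIter (F.P K).L (pull (bgUnits F K W) (basePt F n K)) l) (((F.P K).L : ℤ) • z) κ))⁻¹ :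
                  (Matrix (Fin 2) (Fin 2) ℂ)ˣ) : Matrix (Fin 2) (Fin 2) ℂ)
            + ((expUnit (Xavg (F.P K).L (avgIter (F.P K).L (pull (bgUnits F K W) (basePt F n K)) l) (((F.P K).L : ℤ) • z) κ) : (Matrix (Fin 2) (Fin 2) ℂ)ˣ) :
                  Matrix (Fin 2) (Fin 2) ℂ)
                * tsum (avgIter (F.P K).L (pull (bgUnits F K W) (basePt F n K)) l)
                  ((fun x μ => ((tildIter (F.P K).L (pull (bgUnits F K W) (basePt F n K)) (expCfg fun x μ => Complex.I • X ⟨transl (basePt F n K) x, μ⟩) l x μ :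
                      (Matrix (Fin 2) (Fin 2) ℂ)ˣ) : Matrix (Fin 2) (Fin 2) ℂ) - 1)
                    - Q l (fun x μ => Complex.I • X ⟨transl (basePt F n K) x, μ⟩))
                  (((F.P K).L : ℤ) • z) (seg κ ((F.P K).L : ℤ))
              * (((expUnit (Xavg (F.P K).L (avgIter (F.P K).L (pull (bgUnits F K W) (basePt F n K)) l) (((F.P K).L : ℤ) • z) κ))⁻¹ :
                  (Matrix (Fin 2) (Fin 2) ℂ)ˣ) : Matrix (Fin 2) (Fin 2) ℂ))‖
      ≤ 260 * (((2 * ((F.P K).d : ℝ) + 2) * ((F.P K).L : ℝ)) ^ 2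
          * ∑ s : Fin (F.P K).d → Fin (F.P K).L, ∑ ν : Fin (F.P K).d,
            (‖((tildIter (F.P K).L (pull (bgUnits F K W) (basePt F n K)) (expCfg fun x μ => Complex.I • X ⟨transl (basePt F n K) x, μ⟩) l
                  (((F.P K).L : ℤ) • z + boxVec (F.P K).L s) ν : (Matrix (Fin 2) (Fin 2) ℂ)ˣ) : Matrix (Fin 2) (Fin 2) ℂ) - 1‖ ^ 2
              + ‖((tildIter (F.P K).L (pull (bgUnits F K W) (basePt F n K)) (expCfg fun x μ => Complex.I • X ⟨transl (basePt F n K) x, μ⟩) l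
                  (((F.P K).L : ℤ) • z + ((F.P K).L : ℤ) • e κ + boxVec (F.P K).L s) ν : (Matrix (Fin 2) (Fin 2) ℂ)ˣ) : Matrix (Fin 2) (Fin 2) ℂ) - 1‖ ^ 2)) := by
  letI : CStarAlgebra (Matrix (Fin 2) (Fin 2) ℂ) := B10Eq29TubeLine.cstarAlgebraMatrix 2
  have hL1 : 1 ≤ (F.P K).L := le_trans (by norm_num) (F.P K).hL.2
  have hL3 : (3 : ℝ) ≤ F.L := by
    have h3 : 3 ≤ F.L := by obtain ⟨a, ha⟩ := F.hL.1; have := F.hL.2; omega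
    exact_mod_cast h3
  have hε3 : 10 ^ 7 * (F.L : ℝ) ^ 3 * ε₀ ≤ 1 := by
    have h34 : (F.L : ℝ) ^ 3 ≤ (F.L : ℝ) ^ 4 := pow_le_pow_right₀ (by linarith) (by norm_num)
    exact (mul_le_mul_of_nonneg_right (mul_le_mul_of_nonneg_left h34 (by norm_num)) hε₀.le).trans hε
  -- ★routeR-w6's rows at level `l`
  obtain ⟨hA, -, -, -, hT, hTu⟩ := comb_level_rows_of_regPr F hε₀ hε3 W hreg X hX hX6 l hl.le
  set U₀' := pull (bgUnits F K W) (basePt F n K) with hU₀'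
  set B' : LSite (F.P K).d → Fin (F.P K).d → Matrix (Fin 2) (Fin 2) ℂ := fun x μ => Complex.I • X ⟨transl (basePt F n K) x, μ⟩ with hB'
  have hV₁ : ∀ x μ, tildIter (F.P K).L U₀' (expCfg B') l x μ ∈ U1 (Matrix (Fin 2) (Fin 2) ℂ) := fun x μ => unitaryUnits_le_U1 (hTu x μ)
  -- the two windows
  have hwin := sqrt_twoBlock_le_of_sup F (K := K) hε₀.le hε
    (f := fun s ν => ‖((tildIter (F.P K).L U₀' (expCfg B') l (((F.P K).L : ℤ) • z + boxVec (F.P K).L s) ν : (Matrix (Fin 2) (Fin 2) ℂ)ˣ) : Matrix (Fin 2) (Fin 2) ℂ) - 1‖ ^ 2)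
    (g := fun s ν => ‖((tildIter (F.P K).L U₀' (expCfg B') l (((F.P K).L : ℤ) • z + ((F.P K).L : ℤ) • e κ + boxVec (F.P K).L s) ν : (Matrix (Fin 2) (Fin 2) ℂ)ˣ) :
      Matrix (Fin 2) (Fin 2) ℂ) - 1‖ ^ 2)
    (fun s ν => pow_le_pow_left₀ (norm_nonneg _) (hT _ _) 2) (fun s ν => pow_le_pow_left₀ (norm_nonneg _) (hT _ _) 2)
  have hα : ∀ r : Fin (F.P K).d → Fin (F.P K).L,
      ‖((Wcx (F.P K).L (avgIter (F.P K).L U₀' l) (((F.P K).L : ℤ) • z) κ (boxVec (F.P K).L r) : (Matrix (Fin 2) (Fin 2) ℂ)ˣ) : Matrix (Fin 2) (Fin 2) ℂ) - 1‖ ≤ 1 / 64 :=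
    fun r => hW64 l hl.le _ κ r
  exact norm_rem2_succ_sub_trueStep_le_twoBlock (F.P K).L hL1 U₀' (expCfg B') l hA hV₁ _ (fun _ _ => rfl) Q B' (fun z' κ' => hQs l B' z' κ') z κ hwin.2 hα
    (by norm_num)

end Member

end Summit.QuantumFields.YangMills.Theorems.Prop7CombTildRem2OfRegPrT3

end
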